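import Literature.MathematicalPhysics.QuantumFieldTheory.ConformalBootstrap3D.MixedEvenTail
import Literature.MathematicalPhysics.QuantumFieldTheory.ConformalBootstrap3D.MixedBlockCauchySchwarz

/-!
# The odd-sector tail of a mixed `σ–ε` point certificate: domination by the reflection-positive channel

For the `c_ℓ = 1` blocks of A2 the `ℤ₂`-odd form of a 5-row functional is
`oddForm(g₁, g₂) = (-1)^ℓ α₃(F^{s}_{-}[g₁]) + α₄(F^{Δ_σ}_{-}[g₂]) - α₅(F^{Δ_σ}_{+}[g₂])`,
`s = (Δ_σ+Δ_ε)/2`, `g₁ = gmm = g^{Δ_σε,Δ_σε}` (the `σεσε` channel, SIGNED `z`-series),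
`g₂ = gpm = g^{-Δ_σε,Δ_σε}` (the `εσσε` channel, NON-NEGATIVE `z`-series `A(c,c) ≥ 0`,
`hrCoeffAB_self_nonneg`) — `CrossingFunctional.oddForm` after the ERRATUM 2026-08-19 of
`SigmaEpsilonData.SatisfiesCrossing`. The block-level Cauchy–Schwarz inequality
`|gmm(x,y)| ≤ ((1-x)(1-y))^{Δ_σε/2} gpm(x,y)` at real points (`IsConformalBlock3D.abs_gmm_le`,
Pappadopulo–Rychkov–Espin–Rattazzi 2012 §5 with the Dolan–Osborn conjugation symmetry) and the
exponent identity `s + Δ_σε/2 = Δ_σ` give, for a POINT functional `φ = Σ_k w_k ev_{(z_k, z̄_k)}`,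
`|φ_{w³}[F^{s}_{-}[gmm]]| ≤ φ_{|w³|}[F^{Δ_σ}_{+}[gpm]]` (`abs_pointFunctional_crossF_gmm_le`), hence
`oddForm(gmm, gpm) ≥ 𝔇[gpm] := φ_{w⁴}[F^{Δ_σ}_{-}[gpm]] - φ_{w⁵}[F^{Δ_σ}_{+}[gpm]] - φ_{|w³|}[F^{Δ_σ}_{+}[gpm]]`
(`oddDomEval`, `oddDomEval_le_oddForm_ofPoints`) — a functional of the reflection-positive block ALONE.
Its `z`-series has non-negative coefficients, so the odd sector admits a termwise tail rule of exactly
the shape of the single-correlator rules (M)/(T) — coefficient-free, uniform in the spin AND ITS PARITY: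
with the two weight vectors `c = w⁴ - w⁵ - |w³|` (direct) and `d = w⁴ + w⁵ + |w³|` (reflected),
`𝔇[𝒫_{E,j}] = twoWeightEval c d Δ_σ 𝒫_{E,j}` (`oddDomEval_zMono_eq_twoWeightEval`);
* (M_odd) on a box `E ∈ [E₁,E₂]`, `Δ_σ ∈ [σ_lo,σ_hi]`: `cornerBound₂ c d j E₁ E₂ σ_lo σ_hi ≥ 0`
  (`oddDomEval_nonneg_of_cornerBound₂`);
* (T_odd) apex `a` dominating all nodes: `w⁴_a - w⁵_a - |w³_a| ≥ 0` and
  `R(w⁴; σ_lo, E_T) + R(w⁵; σ_lo, E_T) + R(|w³|; σ_lo, E_T) ≤ (w⁴_a - w⁵_a - |w³_a|) v_a^{σ_hi}`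
  (`oddDomEval_nonneg_of_apex`, `R = apexRest`);
together they discharge obligation (D5) of `MixedObligations` (`tail_oddPositive_of_boxes_and_apex`) and
give the schema `boxExcluded_of_mixedPointRules₂` in which only the finitely many light blocks of both
sectors below `E₀` remain hypotheses. In the tree `w³ = w 2`, `w⁴ = w 3`, `w⁵ = w 4`.
The rule is SUFFICIENT, not an identity: it budgets the `σεσε` row at its Cauchy–Schwarz worst case.
[cite: PappadopuloRychkovEspinRattazzi2012, §5]
-/

noncomputable section

namespace Literature.MathematicalPhysics.QuantumFieldTheory.ConformalBootstrap3D

open Finset Set Filter Topology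

/-! ### The Cauchy–Schwarz budget of the `σεσε` row -/

/-- **`|φ_w[F^{s}_{-}[gmm]]| ≤ φ_{|w|}[F^{s+Δ_σε/2}_{+}[gpm]]`** for a point functional with nodes in the
open square, at a regular `(Δ, ℓ)` above the bound (`Δ ≠ 1` if `ℓ = 0`): from
`|gmm| ≤ v^{Δ_σε/2} gpm` at `(z_k, z̄_k)` and at `(1-z_k, 1-z̄_k)`.
[cite: PappadopuloRychkovEspinRattazzi2012, §5] -/
theorem abs_pointFunctional_crossF_gmm_le {N : ℕ} (w z zb : Fin N → ℝ)
    (hz : ∀ k, z k ∈ Ioo (0 : ℝ) 1) (hzb : ∀ k, zb k ∈ Ioo (0 : ℝ) 1) {d Δ : ℝ} {ℓ : ℕ}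
    {g₁ g₂ : ℝ → ℝ → ℝ} (hΔ : unitarityBound3D ℓ < Δ) (hreg : ¬ accidentalDegeneracy3D Δ ℓ)
    (h1 : ℓ = 0 → Δ ≠ 1) (hg₁ : IsConformalBlock3D d d Δ ℓ g₁)
    (hg₂ : IsConformalBlock3D (-d) d Δ ℓ g₂) (s : ℝ) :
    |pointFunctional w z zb (crossF s (-1) g₁)| ≤
      pointFunctional (fun k => |w k|) z zb (crossF (s + d / 2) 1 g₂) := by
  rw [pointFunctional_apply, pointFunctional_apply]
  refine (abs_sum_le_sum_abs _ _).trans (sum_le_sum fun k _ => ?_)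
  rw [abs_mul]
  refine mul_le_mul_of_nonneg_left ?_ (abs_nonneg _)
  have hz0 := (hz k).1; have hz1 := (hz k).2; have hzb0 := (hzb k).1; have hzb1 := (hzb k).2
  have hv : 0 < (1 - z k) * (1 - zb k) := mul_pos (by linarith) (by linarith)
  have hu : 0 < z k * zb k := mul_pos hz0 hzb0
  have hA : |g₁ (z k) (zb k)| ≤ ((1 - z k) * (1 - zb k)) ^ (d / 2) * g₂ (z k) (zb k) :=
    hg₁.abs_gmm_le hΔ hreg h1 hg₂ (hz k) (hzb k)
  have hB : |g₁ (1 - z k) (1 - zb k)| ≤ (z k * zb k) ^ (d / 2) * g₂ (1 - z k) (1 - zb k) := by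
    have h := hg₁.abs_gmm_le hΔ hreg h1 hg₂ (x := 1 - z k) (y := 1 - zb k)
      ⟨by linarith, by linarith⟩ ⟨by linarith, by linarith⟩
    simpa only [sub_sub_cancel] using h
  have e1 : |((1 - z k) * (1 - zb k)) ^ s * g₁ (z k) (zb k)| ≤
      ((1 - z k) * (1 - zb k)) ^ (s + d / 2) * g₂ (z k) (zb k) := by
    rw [abs_mul, abs_of_pos (Real.rpow_pos_of_pos hv s), Real.rpow_add hv, mul_assoc]
    exact mul_le_mul_of_nonneg_left hA (Real.rpow_pos_of_pos hv s).le
  have e2 : |(-1 : ℝ) * (z k * zb k) ^ s * g₁ (1 - z k) (1 - zb k)| ≤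
      (1 : ℝ) * (z k * zb k) ^ (s + d / 2) * g₂ (1 - z k) (1 - zb k) := by
    have hre : (-1 : ℝ) * (z k * zb k) ^ s * g₁ (1 - z k) (1 - zb k) =
        -((z k * zb k) ^ s * g₁ (1 - z k) (1 - zb k)) := by ring
    rw [hre, abs_neg, abs_mul, abs_of_pos (Real.rpow_pos_of_pos hu s), one_mul, Real.rpow_add hu,
      mul_assoc]
    exact mul_le_mul_of_nonneg_left hB (Real.rpow_pos_of_pos hu s).le
  unfold crossF
  exact (abs_add_le _ _).trans (add_le_add e1 e2)

/-- **The dominating evaluation** `𝔇_w[g] = φ_{w⁴}[F^{t}_{-}[g]] - φ_{w⁵}[F^{t}_{+}[g]] - φ_{|w³|}[F^{t}_{+}[g]]`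
of a point 5-vector (`w³ = w 2`, `w⁴ = w 3`, `w⁵ = w 4`). [folklore] -/
def oddDomEval {N : ℕ} (z zb : Fin N → ℝ) (w : Fin 5 → Fin N → ℝ) (t : ℝ) (g : ℝ → ℝ → ℝ) : ℝ :=
  pointFunctional (w 3) z zb (crossF t (-1) g) - pointFunctional (w 4) z zb (crossF t 1 g) -
    pointFunctional (fun k => |w 2 k|) z zb (crossF t 1 g)

/-- **`oddForm(gmm, gpm) ≥ 𝔇[gpm]`** at a regular `(Δ, ℓ)` above the bound (`Δ ≠ 1` if `ℓ = 0`),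
for genuine blocks `gmm = g^{Δ_σε,Δ_σε}_{Δ,ℓ}`, `gpm = g^{-Δ_σε,Δ_σε}_{Δ,ℓ}`; uses `s + Δ_σε/2 = Δ_σ`.
[cite: PappadopuloRychkovEspinRattazzi2012, §5] -/
theorem oddDomEval_le_oddForm_ofPoints {N : ℕ} (z zb : Fin N → ℝ) (w : Fin 5 → Fin N → ℝ)
    (hz : ∀ k, z k ∈ Ioo (0 : ℝ) 1) (hzb : ∀ k, zb k ∈ Ioo (0 : ℝ) 1) {Δσ Δε Δ : ℝ} {ℓ : ℕ}
    {g₁ g₂ : ℝ → ℝ → ℝ} (hΔ : unitarityBound3D ℓ < Δ) (hreg : ¬ accidentalDegeneracy3D Δ ℓ)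
    (h1 : ℓ = 0 → Δ ≠ 1) (hg₁ : IsConformalBlock3D (Δσ - Δε) (Δσ - Δε) Δ ℓ g₁)
    (hg₂ : IsConformalBlock3D (-(Δσ - Δε)) (Δσ - Δε) Δ ℓ g₂) :
    oddDomEval z zb w Δσ g₂ ≤ (CrossingFunctional.ofPoints z zb w).oddForm Δσ Δε ℓ g₁ g₂ := by
  have hb := abs_pointFunctional_crossF_gmm_le (w 2) z zb hz hzb hΔ hreg h1 hg₁ hg₂ ((Δσ + Δε) / 2)
  have hs : (Δσ + Δε) / 2 + (Δσ - Δε) / 2 = Δσ := by ring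
  rw [hs] at hb
  have hL : (CrossingFunctional.ofPoints z zb w).oddForm Δσ Δε ℓ g₁ g₂ =
      (-1 : ℝ) ^ ℓ * pointFunctional (w 2) z zb (crossF ((Δσ + Δε) / 2) (-1) g₁) +
        (pointFunctional (w 3) z zb (crossF Δσ (-1) g₂) -
          pointFunctional (w 4) z zb (crossF Δσ 1 g₂)) := by
    simp only [CrossingFunctional.oddForm, CrossingFunctional.ofPoints]
    ring
  rw [hL]
  unfold oddDomEval
  have hsgn : |(-1 : ℝ) ^ ℓ * pointFunctional (w 2) z zb (crossF ((Δσ + Δε) / 2) (-1) g₁)| =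
      |pointFunctional (w 2) z zb (crossF ((Δσ + Δε) / 2) (-1) g₁)| := by
    rw [abs_mul, abs_pow, abs_neg, abs_one, one_pow, one_mul]
  have hlow := neg_abs_le ((-1 : ℝ) ^ ℓ * pointFunctional (w 2) z zb (crossF ((Δσ + Δε) / 2) (-1) g₁))
  rw [hsgn] at hlow
  linarith

/-! ### The dominating evaluation is a non-negative-coefficient `z`-series -/

/-- **Level series of `𝔇[gpm]`** at a regular `(Δ, ℓ)`: `𝔇[g^{-d,d}_{Δ,ℓ}] = Σ_m Σ_{j ≤ ℓ+m}
(A_{m,j}(d/2,d/2)/λ_ℓ) 𝔇[𝒫_{Δ+m,j}]`. [cite: DolanOsborn2004, §3 eq. (3.10)] -/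
theorem hasSum_oddDomEval_ofPoints {N : ℕ} (z zb : Fin N → ℝ) (w : Fin 5 → Fin N → ℝ)
    (hz : ∀ k, z k ∈ Ioo (0 : ℝ) 1) (hzb : ∀ k, zb k ∈ Ioo (0 : ℝ) 1) (t : ℝ) {d Δ : ℝ} {ℓ : ℕ}
    {g₂ : ℝ → ℝ → ℝ} (hΔ : unitarityBound3D ℓ < Δ) (hreg : ¬ accidentalDegeneracy3D Δ ℓ)
    (hg₂ : IsConformalBlock3D (-d) d Δ ℓ g₂) :
    HasSum (fun m : ℕ => ∑ j ∈ range (ℓ + m + 1),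
        hrCoeffAB (d / 2) (d / 2) Δ ℓ m j / legendreLam ℓ * oddDomEval z zb w t (zMono (Δ + (m : ℝ)) j))
      (oddDomEval z zb w t g₂) := by
  have h4 := hasSum_pointFunctional_crossF_hrLevelAB (w 3) z zb hz hzb t (-1) hΔ hreg hg₂
  have h5 := hasSum_pointFunctional_crossF_hrLevelAB (w 4) z zb hz hzb t 1 hΔ hreg hg₂
  have h2 := hasSum_pointFunctional_crossF_hrLevelAB (fun k => |w 2 k|) z zb hz hzb t 1 hΔ hreg hg₂
  simp only [neg_neg] at h4 h5 h2
  have hs := (h4.sub h5).sub h2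
  unfold oddDomEval
  refine hs.congr_fun fun m => ?_
  rw [← sum_sub_distrib, ← sum_sub_distrib]
  refine sum_congr rfl fun j _ => ?_
  ring

/-- **Termwise domination gives odd-sector positivity** at a regular `(Δ, ℓ)` above the bound
(`Δ ≠ 1` if `ℓ = 0`): if `𝔇[𝒫_{Δ+m,j}] ≥ 0` on the descendant range then `OddPositive` at `(Δ, ℓ)`
(`A_{m,j}(c,c) ≥ 0`, `hrCoeffAB_self_nonneg`). [cite: PappadopuloRychkovEspinRattazzi2012, §5] -/
theorem oddPositive_ofPoints_of_dom_termwise {N : ℕ} (z zb : Fin N → ℝ) (w : Fin 5 → Fin N → ℝ)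
    (hz : ∀ k, z k ∈ Ioo (0 : ℝ) 1) (hzb : ∀ k, zb k ∈ Ioo (0 : ℝ) 1) {Δσ Δε Δ : ℝ} {ℓ : ℕ}
    (hΔ : unitarityBound3D ℓ < Δ) (hreg : ¬ accidentalDegeneracy3D Δ ℓ) (h1 : ℓ = 0 → Δ ≠ 1)
    (hterm : ∀ q : ℕ × ℕ, InDescendantRange ℓ q.1 q.2 →
      0 ≤ oddDomEval z zb w Δσ (zMono (Δ + (q.1 : ℝ)) q.2)) :
    (CrossingFunctional.ofPoints z zb w).OddPositive Δσ Δε Δ ℓ := by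
  intro g₁ g₂ hg₁ hg₂
  refine le_trans ?_ (oddDomEval_le_oddForm_ofPoints z zb w hz hzb hΔ hreg h1 hg₁ hg₂)
  have hS := hasSum_oddDomEval_ofPoints z zb w hz hzb Δσ (d := Δσ - Δε) hΔ hreg hg₂
  refine hS.nonneg fun m => sum_nonneg fun j _ => ?_
  by_cases hr : InDescendantRange ℓ m j
  · exact mul_nonneg (div_nonneg (hrCoeffAB_self_nonneg _ hΔ m j) (legendreLam_pos ℓ).le)
      (hterm (m, j) hr)
  · rw [hrCoeffAB_eq_zero_of_not_inDescendantRange _ _ Δ hr]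
    simp

/-! ### Rules (M_odd) and (T_odd) -/

/-- `𝔇[g]` is the two-weight evaluation with `c = w⁴ - w⁵ - |w³|`, `d = w⁴ + w⁵ + |w³|`. [folklore] -/
theorem oddDomEval_eq_twoWeightEval {N : ℕ} (z zb : Fin N → ℝ) (w : Fin 5 → Fin N → ℝ) (t : ℝ)
    (g : ℝ → ℝ → ℝ) :
    oddDomEval z zb w t g =
      twoWeightEval (fun k => w 3 k - w 4 k - |w 2 k|) (fun k => w 3 k + w 4 k + |w 2 k|) z zb t g := by
  simp only [oddDomEval, pointFunctional_apply, crossF, twoWeightEval, ← sum_sub_distrib]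
  refine sum_congr rfl fun k _ => ?_
  ring

/-- **(M_odd) on a box from one number.** `cornerBound₂ (w⁴-w⁵-|w³|) (w⁴+w⁵+|w³|) j E₁ E₂ σ_lo σ_hi ≥ 0`
gives `𝔇[𝒫_{E,j}] ≥ 0` for every `E ∈ [E₁,E₂]`, `Δ_σ ∈ [σ_lo,σ_hi]`. [folklore] -/
theorem oddDomEval_nonneg_of_cornerBound₂ {N : ℕ} (z zb : Fin N → ℝ) (w : Fin 5 → Fin N → ℝ)
    (hz : ∀ k, z k ∈ Ioo (0 : ℝ) 1) (hzb : ∀ k, zb k ∈ Ioo (0 : ℝ) 1) (j : ℕ)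
    {E₁ E₂ σlo σhi : ℝ}
    (h : 0 ≤ cornerBound₂ (fun k => w 3 k - w 4 k - |w 2 k|) (fun k => w 3 k + w 4 k + |w 2 k|)
      z zb j E₁ E₂ σlo σhi)
    {E t : ℝ} (hE : E ∈ Icc E₁ E₂) (ht : t ∈ Icc σlo σhi) :
    0 ≤ oddDomEval z zb w t (zMono E j) := by
  rw [oddDomEval_eq_twoWeightEval]
  exact h.trans (cornerBound₂_le _ _ z zb hz hzb j hE ht)

/-- **(T_odd).** In the dominated configuration (apex `a`), with `v_a = (1-z_a)(1-z̄_a)`: the checks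
`w⁴_a - w⁵_a - |w³_a| ≥ 0` and
`R(w⁴; σ_lo, E_T) + R(w⁵; σ_lo, E_T) + R(|w³|; σ_lo, E_T) ≤ (w⁴_a - w⁵_a - |w³_a|) v_a^{σ_hi}` give
`𝔇[𝒫_{E,j}] ≥ 0` for every `E ≥ E_T`, `j ≤ E`, `Δ_σ ∈ [σ_lo, σ_hi]`. [folklore] -/
theorem oddDomEval_nonneg_of_apex {N : ℕ} (z zb : Fin N → ℝ) (w : Fin 5 → Fin N → ℝ)
    (hz : ∀ k, z k ∈ Ioo (0 : ℝ) 1) (hzb : ∀ k, zb k ∈ Ioo (0 : ℝ) 1) (hord : ∀ k, zb k ≤ z k)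
    (a : Fin N) (qd qr : Fin N → ℝ) (hqd : ∀ k, 0 < qd k ∧ qd k ≤ 1)
    (hqr : ∀ k, 0 < qr k ∧ qr k ≤ 1)
    (hdomd : ∀ k, z k * zb k ≤ qd k ^ 2 * (z a * zb a) ∧ z k ≤ qd k * z a)
    (hdomr : ∀ k, (1 - z k) * (1 - zb k) ≤ qr k ^ 2 * (z a * zb a) ∧ 1 - zb k ≤ qr k * z a)
    {σlo σhi ET : ℝ} (hc : 0 ≤ w 3 a - w 4 a - |w 2 a|)
    (hT : apexRest (w 3) z zb a qd qr σlo ET + apexRest (w 4) z zb a qd qr σlo ET +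
        apexRest (fun k => |w 2 k|) z zb a qd qr σlo ET ≤
      (w 3 a - w 4 a - |w 2 a|) * ((1 - z a) * (1 - zb a)) ^ σhi) :
    ∀ E : ℝ, ET ≤ E → ∀ j : ℕ, (j : ℝ) ≤ E → ∀ t ∈ Icc σlo σhi,
      0 ≤ oddDomEval z zb w t (zMono E j) := by
  intro E hE j hj t ht
  have hqd0 : ∀ k, 0 < qd k := fun k => (hqd k).1
  have hqr0 : ∀ k, 0 < qr k := fun k => (hqr k).1
  have hone : |(1 : ℝ)| ≤ 1 := by simp
  have hmone : |(-1 : ℝ)| ≤ 1 := by simp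
  have b3 := (apex_bounds_pointFunctional_crossF_zMono (w 3) z zb hz hzb hord a qd qr hqd0 hqr0
    hdomd hdomr hj t (-1) hmone).1
  have b4 := (apex_bounds_pointFunctional_crossF_zMono (w 4) z zb hz hzb hord a qd qr hqd0 hqr0
    hdomd hdomr hj t 1 hone).2
  have b2 := (apex_bounds_pointFunctional_crossF_zMono (fun k => |w 2 k|) z zb hz hzb hord a qd qr
    hqd0 hqr0 hdomd hdomr hj t 1 hone).2
  set P := zMono E j (z a) (zb a) with hPdef
  set V := ((1 - z a) * (1 - zb a)) ^ t with hVdef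
  set R3 := apexRest (w 3) z zb a qd qr t E
  set R4 := apexRest (w 4) z zb a qd qr t E
  set R2 := apexRest (fun k => |w 2 k|) z zb a qd qr t E
  have hP : 0 ≤ P := zMono_nonneg E j (hz a).1.le (hzb a).1.le
  have hva : 0 < (1 - z a) * (1 - zb a) ∧ (1 - z a) * (1 - zb a) ≤ 1 :=
    ⟨mul_pos (by linarith [(hz a).2]) (by linarith [(hzb a).2]),
      mul_le_one₀ (by linarith [(hz a).1]) (by linarith [(hzb a).2]) (by linarith [(hzb a).1])⟩
  have hV : ((1 - z a) * (1 - zb a)) ^ σhi ≤ V :=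
    Real.rpow_le_rpow_of_exponent_ge hva.1 hva.2 ht.2
  have hqd0' : ∀ k, 0 ≤ qd k := fun k => (hqd0 k).le
  have hqr0' : ∀ k, 0 ≤ qr k := fun k => (hqr0 k).le
  have hR3 : R3 ≤ apexRest (w 3) z zb a qd qr σlo ET :=
    (apexRest_anti_level (w 3) z zb hz hzb a qd qr hqd hqr t hE).trans
      (apexRest_anti_exponent (w 3) z zb hz hzb a qd qr hqd0' hqr0' ht.1 ET)
  have hR4 : R4 ≤ apexRest (w 4) z zb a qd qr σlo ET :=
    (apexRest_anti_level (w 4) z zb hz hzb a qd qr hqd hqr t hE).trans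
      (apexRest_anti_exponent (w 4) z zb hz hzb a qd qr hqd0' hqr0' ht.1 ET)
  have hR2 : R2 ≤ apexRest (fun k => |w 2 k|) z zb a qd qr σlo ET :=
    (apexRest_anti_level (fun k => |w 2 k|) z zb hz hzb a qd qr hqd hqr t hE).trans
      (apexRest_anti_exponent (fun k => |w 2 k|) z zb hz hzb a qd qr hqd0' hqr0' ht.1 ET)
  have key : P * ((w 3 a - w 4 a - |w 2 a|) * V - (R3 + R4 + R2)) ≤
      oddDomEval z zb w t (zMono E j) := by
    have hre : P * ((w 3 a - w 4 a - |w 2 a|) * V - (R3 + R4 + R2)) =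
        P * (w 3 a * V - R3) - P * (w 4 a * V + R4) - P * (|w 2 a| * V + R2) := by ring
    rw [hre]
    unfold oddDomEval
    linarith [b3, b4, b2]
  have hin : 0 ≤ (w 3 a - w 4 a - |w 2 a|) * V - (R3 + R4 + R2) := by
    have := mul_le_mul_of_nonneg_left hV hc
    linarith
  exact (mul_nonneg hP hin).trans key

/-! ### The odd-sector tail (D5) from (M_odd) and (T_odd) -/

/-- **(D5) at a regular point, twist-gap domain.** `𝔇[𝒫_{E,j}] ≥ 0` for `E ∈ [E₀, E_T)`,
`j + τ ≤ E` (rule (M_odd), `τ ≤ 1`, `τ ≤ E₀`) and for `E ≥ E_T`, `j ≤ E` (rule (T_odd)) give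
`OddPositive` at every regular `(Δ, ℓ)` with `Δ ≥ E₀ > 1` above the unitarity bound — every spin,
either parity. [cite: PappadopuloRychkovEspinRattazzi2012, §5] -/
theorem tail_oddPositive_of_termwise_regular {N : ℕ} (z zb : Fin N → ℝ) (w : Fin 5 → Fin N → ℝ)
    (hz : ∀ k, z k ∈ Ioo (0 : ℝ) 1) (hzb : ∀ k, zb k ∈ Ioo (0 : ℝ) 1) {Δσ Δε E₀ ET τ : ℝ}
    (hτ1 : τ ≤ 1) (hτ0 : τ ≤ E₀) (hE1 : 1 < E₀)
    (hM : ∀ (j : ℕ) (E : ℝ), E₀ ≤ E → E < ET → (j : ℝ) + τ ≤ E →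
      0 ≤ oddDomEval z zb w Δσ (zMono E j))
    (hT : ∀ E : ℝ, ET ≤ E → ∀ j : ℕ, (j : ℝ) ≤ E → 0 ≤ oddDomEval z zb w Δσ (zMono E j))
    {Δ : ℝ} {ℓ : ℕ} (hΔ : unitarityBound3D ℓ < Δ) (hreg : ¬ accidentalDegeneracy3D Δ ℓ)
    (hΔ0 : E₀ ≤ Δ) :
    (CrossingFunctional.ofPoints z zb w).OddPositive Δσ Δε Δ ℓ := by
  have h1 : ℓ = 0 → Δ ≠ 1 := fun _ => ne_of_gt (by linarith)
  refine oddPositive_ofPoints_of_dom_termwise z zb w hz hzb hΔ hreg h1 fun q hq => ?_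
  have hℓτ : (ℓ : ℝ) + τ ≤ Δ := natCast_add_le_of_unitarityBound3D_lt hτ1 hτ0 hΔ hΔ0
  have hq1 : (q.2 : ℝ) ≤ (ℓ : ℝ) + (q.1 : ℝ) := by exact_mod_cast hq.2.1
  have hjE : (q.2 : ℝ) + τ ≤ Δ + (q.1 : ℝ) := by linarith
  have hjE' : (q.2 : ℝ) ≤ Δ + (q.1 : ℝ) := by
    linarith [natCast_add_half_le_unitarityBound3D ℓ]
  have hE0 : E₀ ≤ Δ + (q.1 : ℝ) := hΔ0.trans (le_add_of_nonneg_right (Nat.cast_nonneg _))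
  by_cases hlt : Δ + (q.1 : ℝ) < ET
  · exact hM q.2 (Δ + (q.1 : ℝ)) hE0 hlt hjE
  · exact hT (Δ + (q.1 : ℝ)) (not_lt.1 hlt) q.2 hjE'

/-- **(D5) on a box, all points.** Uniformly for `(Δ_σ, Δ_ε) ∈ Q ⊆ [σ_lo,σ_hi] × [ε_lo,ε_hi]`, with
(T_odd) discharged by the apex numbers of `oddDomEval_nonneg_of_apex`, at every `Δ ≥ E₀ > 1` with
`unitarityBound3D ℓ ≤ Δ` (non-regular points by right limits), every spin, either parity.
[cite: PappadopuloRychkovEspinRattazzi2012, §5] -/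
theorem tail_oddPositive_of_boxes_and_apex {N : ℕ} (z zb : Fin N → ℝ) (w : Fin 5 → Fin N → ℝ)
    (hz : ∀ k, z k ∈ Ioo (0 : ℝ) 1) (hzb : ∀ k, zb k ∈ Ioo (0 : ℝ) 1) (hord : ∀ k, zb k ≤ z k)
    (a : Fin N) (qd qr : Fin N → ℝ) (hqd : ∀ k, 0 < qd k ∧ qd k ≤ 1)
    (hqr : ∀ k, 0 < qr k ∧ qr k ≤ 1)
    (hdomd : ∀ k, z k * zb k ≤ qd k ^ 2 * (z a * zb a) ∧ z k ≤ qd k * z a)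
    (hdomr : ∀ k, (1 - z k) * (1 - zb k) ≤ qr k ^ 2 * (z a * zb a) ∧ 1 - zb k ≤ qr k * z a)
    {Q : Set (ℝ × ℝ)} {σlo σhi εlo εhi E₀ ET τ : ℝ}
    (hQ : ∀ p ∈ Q, (σlo ≤ p.1 ∧ p.1 ≤ σhi) ∧ (εlo ≤ p.2 ∧ p.2 ≤ εhi))
    (hτ1 : τ ≤ 1) (hτ0 : τ ≤ E₀) (hE1 : 1 < E₀)
    (hM : ∀ (j : ℕ) (E : ℝ), E₀ ≤ E → E < ET → (j : ℝ) + τ ≤ E → ∀ p ∈ Q,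
      0 ≤ oddDomEval z zb w p.1 (zMono E j))
    (hc : 0 ≤ w 3 a - w 4 a - |w 2 a|)
    (hTodd : apexRest (w 3) z zb a qd qr σlo ET + apexRest (w 4) z zb a qd qr σlo ET +
        apexRest (fun k => |w 2 k|) z zb a qd qr σlo ET ≤
      (w 3 a - w 4 a - |w 2 a|) * ((1 - z a) * (1 - zb a)) ^ σhi) :
    ∀ p ∈ Q, ∀ ℓ : ℕ, ∀ Δ : ℝ, unitarityBound3D ℓ ≤ Δ → E₀ ≤ Δ →
      (CrossingFunctional.ofPoints z zb w).OddPositive p.1 p.2 Δ ℓ := by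
  intro p hp ℓ Δ hbd hΔ0
  have hT := oddDomEval_nonneg_of_apex z zb w hz hzb hord a qd qr hqd hqr hdomd hdomr hc hTodd
  have hTp : ∀ E : ℝ, ET ≤ E → ∀ j : ℕ, (j : ℝ) ≤ E → 0 ≤ oddDomEval z zb w p.1 (zMono E j) :=
    fun E hE j hj => hT E hE j hj p.1 ⟨(hQ p hp).1.1, (hQ p hp).1.2⟩
  have hMp : ∀ (j : ℕ) (E : ℝ), E₀ ≤ E → E < ET → (j : ℝ) + τ ≤ E →
      0 ≤ oddDomEval z zb w p.1 (zMono E j) :=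
    fun j E hE hlt hj => hM j E hE hlt hj p hp
  by_cases hregpt : IsRegularPoint3D Δ ℓ
  · exact tail_oddPositive_of_termwise_regular z zb w hz hzb hτ1 hτ0 hE1 hMp hTp
      (lt_of_le_of_ne hbd (Ne.symm hregpt.1)) hregpt.2 hΔ0
  · refine oddPositive_ofPoints_of_eventually_right z zb w hz hzb p.1 p.2 Δ ℓ hregpt ?_
    filter_upwards [eventually_isRegularPoint3D_nhdsGT_of_bound_le hbd, self_mem_nhdsWithin]
      with Δ' hΔ' hgt
    have hgt' : Δ < Δ' := Set.mem_Ioi.1 hgt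
    exact ⟨hΔ', tail_oddPositive_of_termwise_regular z zb w hz hzb hτ1 hτ0 hE1 hMp hTp
      (lt_of_le_of_lt hbd hgt') hΔ'.2 (hΔ0.trans hgt'.le)⟩

/-! ### The schema with both tails closed-form -/

/-- **The mixed point-certificate schema, both tails by rules.** As `boxExcluded_of_mixedPointRules`,
with the odd-sector tail (D5) discharged by (M_odd) on `E ∈ [E₀, E_T)`, `j + τ ≤ E` (box by box through
`oddDomEval_nonneg_of_cornerBound₂`) and the apex checks of (T_odd); the light blocks of both sectors
below `E₀` ((E2)–(E4), (D2)–(D4)) stay hypotheses (cell tables). Requires `E₀ > 1`.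
[cite: KosPolandSimmonsduffin2014, §3.3 eq. (3.16)] -/
theorem boxExcluded_of_mixedPointRules₂ {N : ℕ} {z zb : Fin N → ℝ} {w : Fin 5 → Fin N → ℝ}
    (hz : ∀ k, z k ∈ Ioo (0 : ℝ) 1) (hzb : ∀ k, zb k ∈ Ioo (0 : ℝ) 1) (hord : ∀ k, zb k ≤ z k)
    (a : Fin N) (qd qr : Fin N → ℝ) (hqd : ∀ k, 0 < qd k ∧ qd k ≤ 1)
    (hqr : ∀ k, 0 < qr k ∧ qr k ≤ 1)
    (hdomd : ∀ k, z k * zb k ≤ qd k ^ 2 * (z a * zb a) ∧ z k ≤ qd k * z a)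
    (hdomr : ∀ k, (1 - z k) * (1 - zb k) ≤ qr k ^ 2 * (z a * zb a) ∧ 1 - zb k ≤ qr k * z a)
    {Q : Set (ℝ × ℝ)} {σlo σhi εlo εhi E₀ ET τ : ℝ}
    (hQ : ∀ p ∈ Q, (σlo ≤ p.1 ∧ p.1 ≤ σhi) ∧ (εlo ≤ p.2 ∧ p.2 ≤ εhi))
    (hτ1 : τ ≤ 1) (hτ0 : τ ≤ E₀) (hE1 : 1 < E₀)
    (hI : 0 < termCornerBound (w 0) z zb 0 0 0 σlo σhi + termCornerBound (w 1) z zb 0 0 0 εlo εhi +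
      cornerBound₂ (w 3 + w 4) (w 3 - w 4) z zb 0 0 0 ((σlo + εlo) / 2) ((σhi + εhi) / 2))
    (hE2 : ∀ p ∈ Q, (CrossingFunctional.ofPoints z zb w).EvenPositive p.1 p.2 p.2 0)
    (hE3 : ∀ p ∈ Q, ∀ Δ : ℝ, 3 ≤ Δ → Δ < E₀ →
      (CrossingFunctional.ofPoints z zb w).EvenPositive p.1 p.2 Δ 0)
    (hE4 : ∀ p ∈ Q, ∀ ℓ : ℕ, Even ℓ → ℓ ≠ 0 → ∀ Δ : ℝ, (ℓ : ℝ) + 1 ≤ Δ → Δ < E₀ →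
      (CrossingFunctional.ofPoints z zb w).EvenPositive p.1 p.2 Δ ℓ)
    (hM : ∀ (j : ℕ) (E : ℝ), E₀ ≤ E → E < ET → (j : ℝ) + τ ≤ E → ∀ p ∈ Q,
      ∀ x y : ℝ, 0 ≤ evenTermForm z zb w p.1 p.2 E j x y)
    (h0 : 0 ≤ w 0 a) (h1 : 0 ≤ w 1 a)
    (hX : 0 ≤ w 0 a * ((1 - z a) * (1 - zb a)) ^ σhi - apexRest (w 0) z zb a qd qr σlo ET)
    (hY : 0 ≤ w 1 a * ((1 - z a) * (1 - zb a)) ^ εhi - apexRest (w 1) z zb a qd qr εlo ET)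
    (hZ : (|w 3 a + w 4 a| * ((1 - z a) * (1 - zb a)) ^ ((σlo + εlo) / 2)
            + apexRest (w 3) z zb a qd qr ((σlo + εlo) / 2) ET
            + apexRest (w 4) z zb a qd qr ((σlo + εlo) / 2) ET) ^ 2 ≤
        4 * (w 0 a * ((1 - z a) * (1 - zb a)) ^ σhi - apexRest (w 0) z zb a qd qr σlo ET) *
          (w 1 a * ((1 - z a) * (1 - zb a)) ^ εhi - apexRest (w 1) z zb a qd qr εlo ET))
    (hD2 : ∀ p ∈ Q, (CrossingFunctional.ofPoints z zb w).OddPositive p.1 p.2 p.1 0)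
    (hD3 : ∀ p ∈ Q, ∀ Δ : ℝ, 3 ≤ Δ → Δ < E₀ →
      (CrossingFunctional.ofPoints z zb w).OddPositive p.1 p.2 Δ 0)
    (hD4 : ∀ p ∈ Q, ∀ ℓ : ℕ, ℓ ≠ 0 → ∀ Δ : ℝ, (ℓ : ℝ) + 1 ≤ Δ → Δ < E₀ →
      (CrossingFunctional.ofPoints z zb w).OddPositive p.1 p.2 Δ ℓ)
    (hModd : ∀ (j : ℕ) (E : ℝ), E₀ ≤ E → E < ET → (j : ℝ) + τ ≤ E → ∀ p ∈ Q,
      0 ≤ oddDomEval z zb w p.1 (zMono E j))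
    (hc : 0 ≤ w 3 a - w 4 a - |w 2 a|)
    (hTodd : apexRest (w 3) z zb a qd qr σlo ET + apexRest (w 4) z zb a qd qr σlo ET +
        apexRest (fun k => |w 2 k|) z zb a qd qr σlo ET ≤
      (w 3 a - w 4 a - |w 2 a|) * ((1 - z a) * (1 - zb a)) ^ σhi) :
    BoxExcluded Q :=
  boxExcluded_of_mixedPointRules hz hzb hord a qd qr hqd hqr hdomd hdomr hQ hτ1 hτ0 hI hE2 hE3 hE4 hM
    h0 h1 hX hY hZ hD2 hD3 hD4
    (tail_oddPositive_of_boxes_and_apex z zb w hz hzb hord a qd qr hqd hqr hdomd hdomr hQ hτ1 hτ0 hE1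
      hModd hc hTodd)

end Literature.MathematicalPhysics.QuantumFieldTheory.ConformalBootstrap3D
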